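import Mathlib
import Summits.Ventures.PercRepro2.CoinChainXASixTopGateGen
import Summits.Ventures.PercRepro2.CoinChainXAGateHull

/-!
# The six-cell sub-case on the convex hull of the proved gates, ARBITRARY coin-entered set
(blind cell PercRepro2, night-2 g27; proofs/NIGHT2-DARC.md §68.14)

For `ent = {m}` and ANY `ent' ∋ j` (entry markers `x = 1[m ∈ ·]`, `y = 1[j ∈ ·]`): the closed gate
(`chain_XA'_six_zero_gate_gen`, the certificate `xa_six_zero_cert` through the generic facts), the gate
`d·1[m ∈ W]` and the open gate (`chain_XA'_of_gate_on_De`) and the top gate (`chain_XA'_six_topgate_gen`) give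
(XA′) for every `d' = θ₁·d·1[{m, j} ⊆ W] + θ₂·d·1[m ∈ W] + θ₃·d`, `θᵢ ≥ 0`, `Σθ ≤ 1`
(`chain_XA'_six_gate_hull_gen`).
-/

namespace Summit.Ventures.PercRepro2.Coin

open Classical

section HullGen

variable {V : Type*} [DecidableEq V] {R : Type*} [Field R] [LinearOrder R] [IsStrictOrderedRing R]

/-- FACT 1 on the generic cells: `a₁·(b_u + r₀u) ≤ (o + a₀)·r₁u`. -/
lemma sixg_fact1 (U : Finset V) (m j : V) (ent' : Finset V) (hj : j ∈ ent') (ν c d : Finset V → R)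
    (hν0 : ∀ W, 0 ≤ ν W) (hν : ∀ s ⊆ U, ∀ t ⊆ U, ν s * ν t ≤ ν (s ∩ t) * ν (s ∪ t))
    (hc0 : ∀ W, 0 ≤ c W) (hd0 : ∀ W, 0 ≤ d W)
    (hcd : ∀ s t, c s * d t ≤ c (s ∩ t) * d (s ∪ t)) :
    (∑ W ∈ U.powerset.filter (fun W => m ∉ W ∧ j ∈ W), ν W * c W) * ((∑ W ∈ U.powerset.filter (fun W => m ∈ W ∧ ¬ ∃ r ∈ ent', r ∈ W), ν W * d W) + (∑ W ∈ U.powerset.filter (fun W => m ∈ W ∧ j ∉ W ∧ ∃ r ∈ ent', r ∈ W), ν W * d W)) ≤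
      ((∑ W ∈ U.powerset.filter (fun W => m ∉ W ∧ ¬ ∃ r ∈ ent', r ∈ W), ν W * c W) + (∑ W ∈ U.powerset.filter (fun W => m ∉ W ∧ j ∉ W ∧ ∃ r ∈ ent', r ∈ W), ν W * c W)) * (∑ W ∈ U.powerset.filter (fun W => m ∈ W ∧ j ∈ W), ν W * d W) := by
  have hcd' : ∀ s ⊆ U, ∀ t ⊆ U, ν s * c s * (ν t * d t) ≤ ν (s ∩ t) * c (s ∩ t) * (ν (s ∪ t) * d (s ∪ t)) := by
    intro s hs t ht
    calc ν s * c s * (ν t * d t) = (ν s * ν t) * (c s * d t) := by ring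
      _ ≤ (ν (s ∩ t) * ν (s ∪ t)) * (c (s ∩ t) * d (s ∪ t)) :=
          mul_le_mul (hν s hs t ht) (hcd s t) (mul_nonneg (hc0 _) (hd0 _)) (mul_nonneg (hν0 _) (hν0 _))
      _ = _ := by ring
  have f1 := ad_sets_dec U (fun W => ν W * c W) (fun W => ν W * d W) (fun W => ν W * c W) (fun W => ν W * d W)
    (fun W => mul_nonneg (hν0 W) (hc0 W)) (fun W => mul_nonneg (hν0 W) (hd0 W))
    (fun W => mul_nonneg (hν0 W) (hc0 W)) (fun W => mul_nonneg (hν0 W) (hd0 W))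
    (fun W => m ∉ W ∧ j ∈ W) (fun W => m ∈ W ∧ j ∉ W) (fun W => m ∉ W ∧ j ∉ W) (fun W => m ∈ W ∧ j ∈ W)
    (fun s hs t ht hA hB => ⟨⟨fun h => hA.1 (Finset.mem_inter.1 h).1, fun h => hB.2 (Finset.mem_inter.1 h).2⟩,
      ⟨Finset.mem_union_right _ hB.1, Finset.mem_union_left _ hA.2⟩, hcd' s hs t ht⟩)
  rwa [sum_split_x_gen U m j ent' hj, sum_split_low_gen U m j ent' hj] at f1

/-- FACT 3 on the generic cells: `a₁·a₀u ≤ (o + a₀)·a₁u`. -/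
lemma sixg_fact3 (U : Finset V) (m j : V) (ent' : Finset V) (hj : j ∈ ent') (ν c d : Finset V → R)
    (hν0 : ∀ W, 0 ≤ ν W) (hν : ∀ s ⊆ U, ∀ t ⊆ U, ν s * ν t ≤ ν (s ∩ t) * ν (s ∪ t))
    (hc0 : ∀ W, 0 ≤ c W) (hd0 : ∀ W, 0 ≤ d W)
    (hcd : ∀ s t, c s * d t ≤ c (s ∩ t) * d (s ∪ t)) :
    (∑ W ∈ U.powerset.filter (fun W => m ∉ W ∧ j ∈ W), ν W * c W) * (∑ W ∈ U.powerset.filter (fun W => m ∉ W ∧ j ∉ W ∧ ∃ r ∈ ent', r ∈ W), ν W * d W) ≤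
      ((∑ W ∈ U.powerset.filter (fun W => m ∉ W ∧ ¬ ∃ r ∈ ent', r ∈ W), ν W * c W) + (∑ W ∈ U.powerset.filter (fun W => m ∉ W ∧ j ∉ W ∧ ∃ r ∈ ent', r ∈ W), ν W * c W)) * (∑ W ∈ U.powerset.filter (fun W => m ∉ W ∧ j ∈ W), ν W * d W) := by
  have hcd' : ∀ s ⊆ U, ∀ t ⊆ U, ν s * c s * (ν t * d t) ≤ ν (s ∩ t) * c (s ∩ t) * (ν (s ∪ t) * d (s ∪ t)) := by
    intro s hs t ht
    calc ν s * c s * (ν t * d t) = (ν s * ν t) * (c s * d t) := by ring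
      _ ≤ (ν (s ∩ t) * ν (s ∪ t)) * (c (s ∩ t) * d (s ∪ t)) :=
          mul_le_mul (hν s hs t ht) (hcd s t) (mul_nonneg (hc0 _) (hd0 _)) (mul_nonneg (hν0 _) (hν0 _))
      _ = _ := by ring
  have f3 := ad_sets_dec U (fun W => ν W * c W) (fun W => ν W * d W) (fun W => ν W * c W) (fun W => ν W * d W)
    (fun W => mul_nonneg (hν0 W) (hc0 W)) (fun W => mul_nonneg (hν0 W) (hd0 W))
    (fun W => mul_nonneg (hν0 W) (hc0 W)) (fun W => mul_nonneg (hν0 W) (hd0 W))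
    (fun W => m ∉ W ∧ j ∈ W) (fun W => m ∉ W ∧ j ∉ W ∧ ∃ r ∈ ent', r ∈ W) (fun W => m ∉ W ∧ j ∉ W) (fun W => m ∉ W ∧ j ∈ W)
    (fun s hs t ht hA hB => ⟨⟨fun h => hA.1 (Finset.mem_inter.1 h).1, fun h => hB.2.1 (Finset.mem_inter.1 h).2⟩,
      ⟨fun h => (Finset.mem_union.1 h).elim hA.1 hB.1, Finset.mem_union_left _ hA.2⟩, hcd' s hs t ht⟩)
  rwa [sum_split_low_gen U m j ent' hj] at f3

/-- **THE CLOSED GATE, ARBITRARY `ent'`**. -/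
theorem chain_XA'_six_zero_gate_gen (U : Finset V) (m j : V) (ent' : Finset V) (hj : j ∈ ent')
    (ν c d : Finset V → R)
    (hν0 : ∀ W, 0 ≤ ν W) (hν : ∀ s ⊆ U, ∀ t ⊆ U, ν s * ν t ≤ ν (s ∩ t) * ν (s ∪ t))
    (hc0 : ∀ W, 0 ≤ c W) (hd0 : ∀ W, 0 ≤ d W) (hdc : ∀ W, d W ≤ c W)
    (hcd : ∀ s t, c s * d t ≤ c (s ∩ t) * d (s ∪ t))
    (x y : Finset V → R) (hx : ∀ W, x W = if m ∈ W then 1 else 0)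
    (hy : ∀ W, y W = if j ∈ W then 1 else 0) :
    (((∑ W ∈ U.powerset, ν W * chainMix {m} ent' 0 c d W) * (∑ W ∈ U.powerset, ν W * chainMix {m} ent' 1 c d W * x W) - (∑ W ∈ U.powerset, ν W * chainMix {m} ent' 0 c d W * x W) * (∑ W ∈ U.powerset, ν W * chainMix {m} ent' 1 c d W)) *
          ((∑ W ∈ U.powerset, ν W * chainMix {m} ent' 0 c d W) * (∑ W ∈ U.powerset, ν W * chainMix {m} ent' 0 c (fun _ => 0) W * y W) - (∑ W ∈ U.powerset, ν W * chainMix {m} ent' 0 c d W * y W) * (∑ W ∈ U.powerset, ν W * chainMix {m} ent' 0 c (fun _ => 0) W))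
        + ((∑ W ∈ U.powerset, ν W * chainMix {m} ent' 0 c d W) * (∑ W ∈ U.powerset, ν W * chainMix {m} ent' 1 c d W * y W) - (∑ W ∈ U.powerset, ν W * chainMix {m} ent' 0 c d W * y W) * (∑ W ∈ U.powerset, ν W * chainMix {m} ent' 1 c d W)) *
          ((∑ W ∈ U.powerset, ν W * chainMix {m} ent' 0 c d W) * (∑ W ∈ U.powerset, ν W * chainMix {m} ent' 0 c (fun _ => 0) W * x W) - (∑ W ∈ U.powerset, ν W * chainMix {m} ent' 0 c d W * x W) * (∑ W ∈ U.powerset, ν W * chainMix {m} ent' 0 c (fun _ => 0) W))) ≤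
        (∑ W ∈ U.powerset, ν W * chainMix {m} ent' 0 c d W) * ((∑ W ∈ U.powerset, ν W * chainMix {m} ent' 0 c d W) * (∑ W ∈ U.powerset, ν W * chainMix {m} ent' 0 c d W) * (∑ W ∈ U.powerset, ν W * chainMix {m} ent' 1 c (fun _ => 0) W * (x W * y W))
          - (∑ W ∈ U.powerset, ν W * chainMix {m} ent' 0 c d W) * (∑ W ∈ U.powerset, ν W * chainMix {m} ent' 0 c d W * y W) * (∑ W ∈ U.powerset, ν W * chainMix {m} ent' 1 c (fun _ => 0) W * x W)
          - (∑ W ∈ U.powerset, ν W * chainMix {m} ent' 0 c d W) * (∑ W ∈ U.powerset, ν W * chainMix {m} ent' 0 c d W * x W) * (∑ W ∈ U.powerset, ν W * chainMix {m} ent' 1 c (fun _ => 0) W * y W)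
          + (∑ W ∈ U.powerset, ν W * chainMix {m} ent' 0 c d W * x W) * (∑ W ∈ U.powerset, ν W * chainMix {m} ent' 0 c d W * y W) * (∑ W ∈ U.powerset, ν W * chainMix {m} ent' 1 c (fun _ => 0) W)) := by
  rw [sixg_a0 U m j ent' ν c d hj, sixg_a1 U m j ent' ν c d hj x hx, sixg_a2 U m j ent' ν c d hj y hy,
    sixg_b0 U m j ent' ν c d hj, sixg_b1 U m j ent' ν c d hj x hx, sixg_b2 U m j ent' ν c d hj y hy,
    sixg_e0 U m j ent' ν c (fun _ => 0) hj, sixg_e1 U m j ent' ν c (fun _ => 0) hj x hx,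
    sixg_e2 U m j ent' ν c (fun _ => 0) hj y hy, sixg_g0 U m j ent' ν c (fun _ => 0) hj,
    sixg_g1 U m j ent' ν c (fun _ => 0) hj x hx, sixg_g2 U m j ent' ν c (fun _ => 0) hj y hy,
    sixg_g12 U m j ent' ν c (fun _ => 0) hj x hx y hy]
  simp only [mul_zero, Finset.sum_const_zero, add_zero]
  have hQ0 : (∑ W ∈ U.powerset.filter (fun W => m ∉ W ∧ j ∉ W ∧ ∃ r ∈ ent', r ∈ W), ν W * d W) ≤ (∑ W ∈ U.powerset.filter (fun W => m ∉ W ∧ j ∉ W ∧ ∃ r ∈ ent', r ∈ W), ν W * c W) :=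
    Finset.sum_le_sum (fun W _ => mul_le_mul_of_nonneg_left (hdc W) (hν0 W))
  have hQ1 : (∑ W ∈ U.powerset.filter (fun W => m ∉ W ∧ j ∈ W), ν W * d W) ≤ (∑ W ∈ U.powerset.filter (fun W => m ∉ W ∧ j ∈ W), ν W * c W) :=
    Finset.sum_le_sum (fun W _ => mul_le_mul_of_nonneg_left (hdc W) (hν0 W))
  linear_combination xa_six_zero_cert _ _ _ _ _ _ _ _
    (cell_nonneg U ν c hν0 hc0 (fun W => m ∉ W ∧ ¬ ∃ r ∈ ent', r ∈ W))
    (cell_nonneg U ν c hν0 hc0 (fun W => m ∉ W ∧ j ∉ W ∧ ∃ r ∈ ent', r ∈ W))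
    (cell_nonneg U ν c hν0 hc0 (fun W => m ∉ W ∧ j ∈ W))
    (cell_nonneg U ν d hν0 hd0 (fun W => m ∈ W ∧ ¬ ∃ r ∈ ent', r ∈ W))
    (cell_nonneg U ν d hν0 hd0 (fun W => m ∈ W ∧ j ∉ W ∧ ∃ r ∈ ent', r ∈ W))
    (cell_nonneg U ν d hν0 hd0 (fun W => m ∈ W ∧ j ∈ W)) hQ0 hQ1
    (sixg_fact1 U m j ent' hj ν c d hν0 hν hc0 hd0 hcd) (sixg_fact3 U m j ent' hj ν c d hν0 hν hc0 hd0 hcd)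

/-- **(XA′) ON THE CONVEX HULL OF THE PROVED GATES, ARBITRARY `ent'`**: every
`d' = θ₁·d·1[{m, j} ⊆ W] + θ₂·d·1[m ∈ W] + θ₃·d` with `θᵢ ≥ 0`, `θ₁ + θ₂ + θ₃ ≤ 1`. -/
theorem chain_XA'_six_gate_hull_gen (U : Finset V) (m j : V) (ent' : Finset V) (hj : j ∈ ent')
    (ν c d d' : Finset V → R)
    (hν0 : ∀ W, 0 ≤ ν W) (hν : ∀ s ⊆ U, ∀ t ⊆ U, ν s * ν t ≤ ν (s ∩ t) * ν (s ∪ t))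
    (hc0 : ∀ W, 0 ≤ c W) (hd0 : ∀ W, 0 ≤ d W) (hdc : ∀ W, d W ≤ c W)
    (hcc : ∀ s t, c s * c t ≤ c (s ∩ t) * c (s ∪ t))
    (hdd : ∀ s t, d s * d t ≤ d (s ∩ t) * d (s ∪ t))
    (hcd : ∀ s t, c s * d t ≤ c (s ∩ t) * d (s ∪ t))
    (hratio : ∀ s t, s ⊆ t → d s * c t ≤ c s * d t)
    (θ₁ θ₂ θ₃ : R) (hθ₁ : 0 ≤ θ₁) (hθ₂ : 0 ≤ θ₂) (hθ₃ : 0 ≤ θ₃) (hθ : θ₁ + θ₂ + θ₃ ≤ 1)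
    (hd' : ∀ W, d' W = θ₁ * (if m ∈ W ∧ j ∈ W then d W else 0) + θ₂ * (if m ∈ W then d W else 0) + θ₃ * d W)
    (x y : Finset V → R) (hx : ∀ W, x W = if m ∈ W then 1 else 0)
    (hy : ∀ W, y W = if j ∈ W then 1 else 0) :
    (((∑ W ∈ U.powerset, ν W * chainMix {m} ent' 0 c d W) * (∑ W ∈ U.powerset, ν W * chainMix {m} ent' 1 c d W * x W) - (∑ W ∈ U.powerset, ν W * chainMix {m} ent' 0 c d W * x W) * (∑ W ∈ U.powerset, ν W * chainMix {m} ent' 1 c d W)) *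
          ((∑ W ∈ U.powerset, ν W * chainMix {m} ent' 0 c d W) * (∑ W ∈ U.powerset, ν W * chainMix {m} ent' 0 c d' W * y W) - (∑ W ∈ U.powerset, ν W * chainMix {m} ent' 0 c d W * y W) * (∑ W ∈ U.powerset, ν W * chainMix {m} ent' 0 c d' W))
        + ((∑ W ∈ U.powerset, ν W * chainMix {m} ent' 0 c d W) * (∑ W ∈ U.powerset, ν W * chainMix {m} ent' 1 c d W * y W) - (∑ W ∈ U.powerset, ν W * chainMix {m} ent' 0 c d W * y W) * (∑ W ∈ U.powerset, ν W * chainMix {m} ent' 1 c d W)) *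
          ((∑ W ∈ U.powerset, ν W * chainMix {m} ent' 0 c d W) * (∑ W ∈ U.powerset, ν W * chainMix {m} ent' 0 c d' W * x W) - (∑ W ∈ U.powerset, ν W * chainMix {m} ent' 0 c d W * x W) * (∑ W ∈ U.powerset, ν W * chainMix {m} ent' 0 c d' W))) ≤
        (∑ W ∈ U.powerset, ν W * chainMix {m} ent' 0 c d W) * ((∑ W ∈ U.powerset, ν W * chainMix {m} ent' 0 c d W) * (∑ W ∈ U.powerset, ν W * chainMix {m} ent' 0 c d W) * (∑ W ∈ U.powerset, ν W * chainMix {m} ent' 1 c d' W * (x W * y W))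
          - (∑ W ∈ U.powerset, ν W * chainMix {m} ent' 0 c d W) * (∑ W ∈ U.powerset, ν W * chainMix {m} ent' 0 c d W * y W) * (∑ W ∈ U.powerset, ν W * chainMix {m} ent' 1 c d' W * x W)
          - (∑ W ∈ U.powerset, ν W * chainMix {m} ent' 0 c d W) * (∑ W ∈ U.powerset, ν W * chainMix {m} ent' 0 c d W * x W) * (∑ W ∈ U.powerset, ν W * chainMix {m} ent' 1 c d' W * y W)
          + (∑ W ∈ U.powerset, ν W * chainMix {m} ent' 0 c d W * x W) * (∑ W ∈ U.powerset, ν W * chainMix {m} ent' 0 c d W * y W) * (∑ W ∈ U.powerset, ν W * chainMix {m} ent' 1 c d' W)) := by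
  have hx0 := marker_nonneg m x hx
  have hy0 := marker_nonneg j y hy
  have hxm := marker_mono m x hx
  have hym := marker_mono j y hy
  have ha0 : 0 ≤ ∑ W ∈ U.powerset, ν W * chainMix {m} ent' 0 c d W :=
    Finset.sum_nonneg (fun W _ => mul_nonneg (hν0 W) (chainMix_nonneg _ _ le_rfl zero_le_one hc0 hd0 W))
  refine chain_XA'_of_gate_mix3 U {m} ent' ν c d (fun W => if m ∈ W ∧ j ∈ W then d W else 0) (fun W => if m ∈ W then d W else 0) d d' θ₁ θ₂ θ₃ hθ₁ hθ₂ hθ₃ hθ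
    (fun W => hd' W) x y ?_ ?_ ?_ ?_
  · exact chain_XA'_six_topgate_gen U m j ent' hj ν c d (fun W => if m ∈ W ∧ j ∈ W then d W else 0) hν0 hν hc0 hd0 hdc hcd (fun W => rfl) x y hx hy
  · refine chain_XA'_of_gate_on_De U {m} ent' ν c d (fun W => if m ∈ W then d W else 0) ?_ ha0 x y ?_
    · intro W h
      obtain ⟨r, hr, hrW⟩ := h
      rw [Finset.mem_singleton] at hr
      subst hr
      simp [hrW]
    · exact chain_world1_mixed_nonneg U {m} ent' ν c d (fun W => if m ∈ W then d W else 0) 0 0 le_rfl zero_le_one le_rfl zero_le_one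
        hν0 hν hc0 hd0 (gateM_nonneg m d _ hd0 (fun W => rfl)) hdc
        (fun W => le_trans (gateM_le m d _ hd0 (fun W => rfl) W) (hdc W)) hcc hdd
        (gateM_lsm m d _ hd0 (fun W => rfl) hdd) hcd (gateM_cross m c d _ hc0 hd0 (fun W => rfl) hcd)
        (gateM_cross m d d _ hd0 hd0 (fun W => rfl) hdd) hratio (gateM_ratio m c d _ hc0 hd0 (fun W => rfl) hratio)
        x y hx0 hy0 hxm hym
  · refine chain_XA'_of_gate_on_De U {m} ent' ν c d d (fun W _ => rfl) ha0 x y ?_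
    exact chain_world1_mixed_nonneg U {m} ent' ν c d d 0 0 le_rfl zero_le_one le_rfl zero_le_one
      hν0 hν hc0 hd0 hd0 hdc hdc hcc hdd hdd hcd hcd hdd hratio hratio x y hx0 hy0 hxm hym
  · exact chain_XA'_six_zero_gate_gen U m j ent' hj ν c d hν0 hν hc0 hd0 hdc hcd x y hx hy

end HullGen

end Summit.Ventures.PercRepro2.Coin
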